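import Literature.Computability.FineGrained.IPRenameNewVar
import HarnessLib

/-!
# The renaming machine of Impagliazzo–Paturi's Lemma 2, XII: the occurrence table

Family `fine-grained` (trunk T-CPLX-FINE). Twelfth file of the machine half of Impagliazzo–Paturi's Lemma 2: the pass over all literals of
the clause list building the occurrence table.

* `eraseDups_append`, `eraseDups_append_singleton`, **`pre_eq_eraseDups`** — first occurrences:
  when the variable occurrences read `seen ++ x :: rest` with `x ∉ seen`, `pre F x = seen.eraseDups`;
* `litOc` / `ocBody` / `ocBuild cap`, `runs_litOc_old` / `runs_litOc_new`, the pass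
  (`segRuns_oc_*`) with the invariant `oc = wRecs (ocRecs F cap seen.eraseDups)` (`ocBase`), and
  **`runs_ocBuild`**: started with an empty table, `oc := wRecs (ocRecs F cap (occList F))`.

## References

* R. Impagliazzo, R. Paturi, *On the complexity of k-SAT*, J. Comput. System Sci. 62 (2001)
  367–375, doi:10.1006/jcss.2000.1727, Lemma 2 (p. 373) and its "Moreover" sentence (the
  reduction is computable within the stated time); pp. 371–372 (`G_x`, `Ψ`, `Θ_i`, `Φ_f`).
  (Not held; acquisition request acq-00143.)
* T. Nipkow, G. Klein, *Concrete Semantics with Isabelle/HOL*, Springer 2014, Ch. 7 (big-step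
  reasoning about loops, as in `SymbolPrograms.lean`).
-/

namespace Literature.Computability.FineGrained.IPRenameM

open _root_.Computability Complexity Complexity.ACom Sparsifier IPRename
open Compaction (uflag uflag_true uflag_false eraseDups_append_singleton)

/-! ### Building the occurrence table: invariance of the base -/

/-- `NvBase` survives updates of `fam2` and `pr`. [folklore] -/
theorem NvBase.upd_fam2_pr {S : RStore} {F : List (List (ℕ × Bool))} {cap : ℕ} {zs : List ℕ} (h : NvBase S F cap zs) (w v : List Γ') :
    NvBase (Function.update (Function.update S (kr KR.fam2) w) (kr KR.pr) v) F cap zs :=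
  { fam := by rw [Function.update_of_ne (by simp), Function.update_of_ne (by simp)]; exact h.fam,
    oc := by rw [Function.update_of_ne (by simp), Function.update_of_ne (by simp)]; exact h.oc,
    pr2 := by rw [Function.update_of_ne (by simp), Function.update_of_ne (by simp)]; exact h.pr2,
    t1 := by rw [Function.update_of_ne (by simp), Function.update_of_ne (by simp)]; exact h.t1,
    t2 := by rw [Function.update_of_ne (by simp), Function.update_of_ne (by simp)]; exact h.t2,
    x2 := by rw [Function.update_of_ne (by simp), Function.update_of_ne (by simp)]; exact h.x2,
    vw := by rw [Function.update_of_ne (by simp), Function.update_of_ne (by simp)]; exact h.vw,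
    eb := by rw [Function.update_of_ne (by simp), Function.update_of_ne (by simp)]; exact h.eb,
    lmd := by rw [Function.update_of_ne (by simp), Function.update_of_ne (by simp)]; exact h.lmd,
    dict2 := by rw [Function.update_of_ne (by simp), Function.update_of_ne (by simp)]; exact h.dict2,
    s1 := by rw [Function.update_of_ne (by simp), Function.update_of_ne (by simp)]; exact h.s1,
    md := by rw [Function.update_of_ne (by simp), Function.update_of_ne (by simp)]; exact h.md,
    ex := by rw [Function.update_of_ne (by simp), Function.update_of_ne (by simp)]; exact h.ex,
    ju := by rw [Function.update_of_ne (by simp), Function.update_of_ne (by simp)]; exact h.ju,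
    fl := by rw [Function.update_of_ne (by simp), Function.update_of_ne (by simp)]; exact h.fl,
    cnt := by rw [Function.update_of_ne (by simp), Function.update_of_ne (by simp)]; exact h.cnt,
    s2 := by rw [Function.update_of_ne (by simp), Function.update_of_ne (by simp)]; exact h.s2,
    cols := by rw [Function.update_of_ne (by simp), Function.update_of_ne (by simp)]; exact h.cols,
    ne := by rw [Function.update_of_ne (by simp), Function.update_of_ne (by simp)]; exact h.ne,
    fnd := by rw [Function.update_of_ne (by simp), Function.update_of_ne (by simp)]; exact h.fnd,
    key := by rw [Function.update_of_ne (by simp), Function.update_of_ne (by simp)]; exact h.key,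
    c := by rw [Function.update_of_ne (by simp), Function.update_of_ne (by simp)]; exact h.c,
    u2 := by rw [Function.update_of_ne (by simp), Function.update_of_ne (by simp)]; exact h.u2,
    u3 := by rw [Function.update_of_ne (by simp), Function.update_of_ne (by simp)]; exact h.u3,
    s3 := by rw [Function.update_of_ne (by simp), Function.update_of_ne (by simp)]; exact h.s3,
    s4 := by rw [Function.update_of_ne (by simp), Function.update_of_ne (by simp)]; exact h.s4,
    s5 := by rw [Function.update_of_ne (by simp), Function.update_of_ne (by simp)]; exact h.s5,
    fl2 := by rw [Function.update_of_ne (by simp), Function.update_of_ne (by simp)]; exact h.fl2,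
    fl3 := by rw [Function.update_of_ne (by simp), Function.update_of_ne (by simp)]; exact h.fl3 }

/-- `NvBase` with a new table. [folklore] -/
theorem NvBase.upd_oc {S : RStore} {F : List (List (ℕ × Bool))} {cap : ℕ} {zs : List ℕ} (h : NvBase S F cap zs) (zs' : List ℕ) :
    NvBase (Function.update S (kr KR.oc) (wRecs (ocRecs F cap zs'))) F cap zs' :=
  { fam := by rw [Function.update_of_ne (by simp)]; exact h.fam,
    oc := by simp,
    pr2 := by rw [Function.update_of_ne (by simp)]; exact h.pr2,
    t1 := by rw [Function.update_of_ne (by simp)]; exact h.t1,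
    t2 := by rw [Function.update_of_ne (by simp)]; exact h.t2,
    x2 := by rw [Function.update_of_ne (by simp)]; exact h.x2,
    vw := by rw [Function.update_of_ne (by simp)]; exact h.vw,
    eb := by rw [Function.update_of_ne (by simp)]; exact h.eb,
    lmd := by rw [Function.update_of_ne (by simp)]; exact h.lmd,
    dict2 := by rw [Function.update_of_ne (by simp)]; exact h.dict2,
    s1 := by rw [Function.update_of_ne (by simp)]; exact h.s1,
    md := by rw [Function.update_of_ne (by simp)]; exact h.md,
    ex := by rw [Function.update_of_ne (by simp)]; exact h.ex,
    ju := by rw [Function.update_of_ne (by simp)]; exact h.ju,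
    fl := by rw [Function.update_of_ne (by simp)]; exact h.fl,
    cnt := by rw [Function.update_of_ne (by simp)]; exact h.cnt,
    s2 := by rw [Function.update_of_ne (by simp)]; exact h.s2,
    cols := by rw [Function.update_of_ne (by simp)]; exact h.cols,
    ne := by rw [Function.update_of_ne (by simp)]; exact h.ne,
    fnd := by rw [Function.update_of_ne (by simp)]; exact h.fnd,
    key := by rw [Function.update_of_ne (by simp)]; exact h.key,
    c := by rw [Function.update_of_ne (by simp)]; exact h.c,
    u2 := by rw [Function.update_of_ne (by simp)]; exact h.u2,
    u3 := by rw [Function.update_of_ne (by simp)]; exact h.u3,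
    s3 := by rw [Function.update_of_ne (by simp)]; exact h.s3,
    s4 := by rw [Function.update_of_ne (by simp)]; exact h.s4,
    s5 := by rw [Function.update_of_ne (by simp)]; exact h.s5,
    fl2 := by rw [Function.update_of_ne (by simp)]; exact h.fl2,
    fl3 := by rw [Function.update_of_ne (by simp)]; exact h.fl3 }

/-! ### First occurrences: `eraseDups` over appends, and `pre` -/

/-- `eraseDups` of an append: the first list deduplicated, then the new elements of the second
(length-fuelled form). [folklore] -/
private theorem eraseDups_append' {α : Type} [DecidableEq α] : ∀ (n : ℕ) (l₁ l₂ : List α), l₁.length ≤ n →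
    (l₁ ++ l₂).eraseDups = l₁.eraseDups ++ (l₂.filter fun b => !decide (b ∈ l₁)).eraseDups
  | 0, [], l₂, _ => by simp
  | n + 1, [], l₂, _ => by simp
  | n + 1, a :: l₁, l₂, hn => by
    rw [List.cons_append, List.eraseDups_cons, List.eraseDups_cons, List.filter_append,
      eraseDups_append' n (l₁.filter fun b => !(b == a)) _ ((List.length_filter_le _ _).trans (by simpa using hn))]
    simp only [List.cons_append, List.cons.injEq, true_and, List.append_cancel_left_eq, List.filter_filter]
    congr 1
    refine List.filter_congr fun b _ => ?_
    by_cases hba : b = a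
    · subst hba; simp
    · simp [hba, List.mem_filter]

/-- `eraseDups` of an append: the first list deduplicated, then the new elements of the second.
[folklore] -/
theorem eraseDups_append {α : Type} [DecidableEq α] (l₁ l₂ : List α) :
    (l₁ ++ l₂).eraseDups = l₁.eraseDups ++ (l₂.filter fun b => !decide (b ∈ l₁)).eraseDups :=
  eraseDups_append' _ l₁ l₂ le_rfl

/-- **The earlier variables of a new variable.** If the variable occurrences of `F` read
`seen ++ x :: rest` with `x ∉ seen`, then `pre F x = seen.eraseDups`. [folklore] -/
theorem pre_eq_eraseDups (F : List (List (ℕ × Bool))) (seen rest : List ℕ) (x : ℕ)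
    (hF : (F.flatMap fun c => c.map Prod.fst) = seen ++ x :: rest) (hx : x ∉ seen) : pre F x = seen.eraseDups := by
  unfold pre occList
  rw [hF, eraseDups_append]
  have hfx : ((x :: rest).filter fun b => !decide (b ∈ seen)) = x :: (rest.filter fun b => !decide (b ∈ seen)) := by
    rw [List.filter_cons_of_pos (by simp [hx])]
  rw [hfx, List.eraseDups_cons]
  have hxs : x ∉ seen.eraseDups := fun h => hx (List.mem_eraseDups.1 h)
  rw [List.idxOf_append_of_notMem hxs]
  simp

/-! ### Building the occurrence table: programs -/

/-- At the comma closing a literal on `x` (probe in `pr`): look `x` up; if known, discard; if new,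
`newVar`. [folklore] -/
def litOc (cap : ℕ) : RProg :=
  findRec KR.oc ;; pop (kr KR.fnd) fun o => match o with
    | some _ => clear (kr KR.key) ;; clear (kr KR.pr)
    | none => newVar cap

/-- Body of the pass over the copy `fam2` of the clauses (mode `md` as in `xBody`). [folklore] -/
def ocBody (cap : ℕ) (s : Γ') : RProg :=
  pop (kr KR.md) fun o => match o, s with
    | none, Γ'.bit _ => push (kr KR.md) Γ'.blank
    | none, _ => skip
    | some _, Γ'.bit d => push (kr KR.pr) (Γ'.bit d) ;; push (kr KR.md) Γ'.blank
    | some _, Γ'.comma => litOc cap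
    | some _, _ => skip

/-- **`ocBuild cap`**: build the occurrence table of the clauses in `fam` (records in the order of
first occurrence: key, light flag `occ ≤ cap`, colour `col`). [folklore] -/
def ocBuild (cap : ℕ) : RProg := copyToG (kr KR.fam) (kr KR.fam2) (kr KR.t1) (kr KR.t2) ;; loop (kr KR.fam2) (ocBody cap)

/-- The store family `ocSt` over a base store. [folklore] -/
def ocSt (S : RStore) (fam2 md pr : List Γ') : RStore := fun r =>
  if r = kr KR.fam2 then fam2 else if r = kr KR.md then md else if r = kr KR.pr then pr else S r

section OcstLemmas

variable (S : RStore) (fam2 md pr w : List Γ')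

/-- Reading `fam2`. [folklore] -/
@[simp] theorem ocSt_fam2 : ocSt S fam2 md pr (kr KR.fam2) = fam2 := by simp [ocSt]
/-- Reading `md`. [folklore] -/
@[simp] theorem ocSt_md : ocSt S fam2 md pr (kr KR.md) = md := by simp [ocSt]
/-- Reading `pr`. [folklore] -/
@[simp] theorem ocSt_pr : ocSt S fam2 md pr (kr KR.pr) = pr := by simp [ocSt]
/-- Reading any other register. [folklore] -/
theorem ocSt_other {r : Reg} (h0 : r ≠ kr KR.fam2) (h1 : r ≠ kr KR.md) (h2 : r ≠ kr KR.pr) :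
    ocSt S fam2 md pr r = S r := by simp [ocSt, h0, h1, h2]
/-- Reading `fam`. [folklore] -/
@[simp] theorem ocSt_fam : ocSt S fam2 md pr (kr KR.fam) = S (kr KR.fam) := by simp [ocSt]
/-- Reading `oc`. [folklore] -/
@[simp] theorem ocSt_oc : ocSt S fam2 md pr (kr KR.oc) = S (kr KR.oc) := by simp [ocSt]
/-- Reading `t1`. [folklore] -/
@[simp] theorem ocSt_t1 : ocSt S fam2 md pr (kr KR.t1) = S (kr KR.t1) := by simp [ocSt]
/-- Reading `t2`. [folklore] -/
@[simp] theorem ocSt_t2 : ocSt S fam2 md pr (kr KR.t2) = S (kr KR.t2) := by simp [ocSt]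
/-- Reading `fnd`. [folklore] -/
@[simp] theorem ocSt_fnd : ocSt S fam2 md pr (kr KR.fnd) = S (kr KR.fnd) := by simp [ocSt]
/-- Reading `key`. [folklore] -/
@[simp] theorem ocSt_key : ocSt S fam2 md pr (kr KR.key) = S (kr KR.key) := by simp [ocSt]
/-- Updating `fam2`. [folklore] -/
@[simp] theorem update_ocSt_fam2 : Function.update (ocSt S fam2 md pr) (kr KR.fam2) w = ocSt S w md pr := by
  funext r; by_cases h : r = kr KR.fam2
  · subst h; simp
  · rw [Function.update_of_ne h]; simp [ocSt, h]
/-- Updating `md`. [folklore] -/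
@[simp] theorem update_ocSt_md : Function.update (ocSt S fam2 md pr) (kr KR.md) w = ocSt S fam2 w pr := by
  funext r; by_cases h : r = kr KR.md
  · subst h; simp
  · rw [Function.update_of_ne h]; simp [ocSt, h]
/-- Updating `pr`. [folklore] -/
@[simp] theorem update_ocSt_pr : Function.update (ocSt S fam2 md pr) (kr KR.pr) w = ocSt S fam2 md w := by
  funext r; by_cases h : r = kr KR.pr
  · subst h; simp
  · rw [Function.update_of_ne h]; simp [ocSt, h]

end OcstLemmas

/-- Every store is a `ocSt` over itself. [folklore] -/
theorem ocSt_eta (R : RStore) : ocSt R (R (kr KR.fam2)) (R (kr KR.md)) (R (kr KR.pr)) = R := by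
  funext r
  by_cases h0 : r = kr KR.fam2; · subst h0; simp
  by_cases h1 : r = kr KR.md; · subst h1; simp
  by_cases h2 : r = kr KR.pr; · subst h2; simp
  rw [ocSt_other _ _ _ _ h0 h1 h2]

/-- Updating the table commutes with the family. [folklore] -/
theorem update_ocSt_oc (S : RStore) (fam2 md pr w : List Γ') :
    Function.update (ocSt S fam2 md pr) (kr KR.oc) w = ocSt (Function.update S (kr KR.oc) w) fam2 md pr := by
  funext r; by_cases h : r = kr KR.oc
  · subst h; simp [ocSt]
  · rw [Function.update_of_ne h]; simp only [ocSt, Function.update_of_ne h]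

/-! ### Building the occurrence table: specifications -/

/-- The cost of one literal of the table builder. [folklore] -/
def litOcCost (Lf Lo Wf cap : ℕ) : ℕ := ((12 * Lf + 44) * Lo + 4) + (nvCost Lf Lo Wf cap + 2 * Lo + 2 * Lf + 4)

section OcSpec

variable (F : List (List (ℕ × Bool))) (cap Lf : ℕ) (hF : ∀ c ∈ F, ∀ l ∈ c, (rbits l.1).length ≤ Lf)
include hF

omit hF in
/-- **The literal step** on a known variable. [folklore] -/
theorem runs_litOc_old (S : RStore) (zs : List ℕ) (hN : NvBase S F cap zs) (x : ℕ) (hx : x ∈ zs) (hxL : (rbits x).length ≤ Lf) (fam2 : List Γ') :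
    Runs (litOc cap) (ocSt S fam2 [] (rbits x)) (ocSt S fam2 [] [])
      (litOcCost Lf (wRecs (ocRecs F cap zs)).length (wFam F).length cap) := by
  unfold litOc
  have h1 := runs_findRec' (ocSt S fam2 [] (rbits x)) x KR.oc (by decide) (by decide) (by decide) (by decide) (by decide) (by decide) (by decide)
    (by decide) (by decide) (by decide) (ocRecs F cap zs) (ocRecs_blank_free F cap zs) (by simp [hN.oc]) (by simp) (by rw [ocSt_other] <;> simp [hN.x2])
    (by simp [hN.t1]) (by simp [hN.t2]) (by rw [ocSt_other] <;> simp [hN.dict2]) (by rw [ocSt_other] <;> simp [hN.vw])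
    (by rw [ocSt_other] <;> simp [hN.ex]) (by rw [ocSt_other] <;> simp [hN.eb]) (by rw [ocSt_other] <;> simp [hN.lmd]) (by simp [hN.fnd])
    (by simp [hN.key]) (by rw [ocSt_other] <;> simp [hN.ne])
  rw [recHas_ocRecs, recPay_ocRecs, decide_eq_true hx, if_pos hx] at h1
  set X := Function.update (Function.update (ocSt S fam2 [] (rbits x)) (kr KR.fnd) (uflag true)) (kr KR.key) (ocPay F cap x) with hX
  have h2 := runs_clear (kr KR.key) (Function.update X (kr KR.fnd) [])
  have e2 : Function.update X (kr KR.fnd) [] (kr KR.key) = ocPay F cap x := by simp [hX]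
  rw [e2] at h2
  have h3 := runs_clear (kr KR.pr) (Function.update (Function.update X (kr KR.fnd) []) (kr KR.key) [])
  have e3 : Function.update (Function.update X (kr KR.fnd) []) (kr KR.key) [] (kr KR.pr) = rbits x := by simp [hX]
  rw [e3] at h3
  have h23 : Runs (pop (kr KR.fnd) fun o => match o with
      | some _ => clear (kr KR.key) ;; clear (kr KR.pr)
      | none => newVar cap) X (ocSt S fam2 [] []) ((2 * (ocPay F cap x).length + 1 + (2 * (rbits x).length + 1)) + 2) := by
    refine Runs.pop_cons (k := kr KR.fnd) (a := Γ'.blank) (w := []) (by simp [hX]) ((h2.seq h3).of_eq ?_ le_rfl)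
    rw [hX]
    funext q
    by_cases q1 : q = kr KR.pr; · subst q1; simp
    rw [Function.update_of_ne q1]
    by_cases q2 : q = kr KR.key; · subst q2; simp [hN.key]
    rw [Function.update_of_ne q2]
    by_cases q3 : q = kr KR.fnd; · subst q3; simp [hN.fnd]
    rw [Function.update_of_ne q3, Function.update_of_ne q2, Function.update_of_ne q3]
    simp [ocSt, q1]
  refine (h1.seq h23).mono ?_
  have hp : (ocPay F cap x).length ≤ (wRecs (ocRecs F cap zs)).length := by
    unfold wRecs ocRecs
    obtain ⟨s₁, s₂, hs⟩ := List.append_of_mem hx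
    rw [hs]
    simp only [List.map_append, List.map_cons, List.flatMap_append, List.flatMap_cons, List.length_append, List.length_cons]
    omega
  have hm : (12 * (rbits x).length + 44) * (wRecs (ocRecs F cap zs)).length ≤ (12 * Lf + 44) * (wRecs (ocRecs F cap zs)).length :=
    Nat.mul_le_mul_right _ (by omega)
  unfold litOcCost
  omega

/-- **The literal step** on a new variable. [folklore] -/
theorem runs_litOc_new (S : RStore) (zs : List ℕ) (hN : NvBase S F cap zs) (x : ℕ) (hx : x ∉ zs) (hzs : ∀ z, z ∈ zs ↔ z ∈ pre F x)
    (hxL : (rbits x).length ≤ Lf) (fam2 : List Γ') :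
    Runs (litOc cap) (ocSt S fam2 [] (rbits x)) (ocSt (Function.update S (kr KR.oc) (wRecs (ocRecs F cap (zs ++ [x])))) fam2 [] [])
      (litOcCost Lf (wRecs (ocRecs F cap zs)).length (wFam F).length cap) := by
  unfold litOc
  have h1 := runs_findRec' (ocSt S fam2 [] (rbits x)) x KR.oc (by decide) (by decide) (by decide) (by decide) (by decide) (by decide) (by decide)
    (by decide) (by decide) (by decide) (ocRecs F cap zs) (ocRecs_blank_free F cap zs) (by simp [hN.oc]) (by simp) (by rw [ocSt_other] <;> simp [hN.x2])
    (by simp [hN.t1]) (by simp [hN.t2]) (by rw [ocSt_other] <;> simp [hN.dict2]) (by rw [ocSt_other] <;> simp [hN.vw])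
    (by rw [ocSt_other] <;> simp [hN.ex]) (by rw [ocSt_other] <;> simp [hN.eb]) (by rw [ocSt_other] <;> simp [hN.lmd]) (by simp [hN.fnd])
    (by simp [hN.key]) (by rw [ocSt_other] <;> simp [hN.ne])
  rw [recHas_ocRecs, recPay_ocRecs, decide_eq_false hx, if_neg hx] at h1
  have eX : Function.update (Function.update (ocSt S fam2 [] (rbits x)) (kr KR.fnd) (uflag false)) (kr KR.key) [] = ocSt S fam2 [] (rbits x) := by
    rw [uflag_false, Function.update_eq_self_iff.2 (by simp [hN.key]), Function.update_eq_self_iff.2 (by simp [hN.fnd])]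
  rw [eX] at h1
  have hN' : NvBase (ocSt S fam2 [] (rbits x)) F cap zs := by
    have e : ocSt S fam2 [] (rbits x) = Function.update (Function.update S (kr KR.fam2) fam2) (kr KR.pr) (rbits x) := by
      funext r
      by_cases h0 : r = kr KR.pr; · subst h0; simp
      rw [Function.update_of_ne h0]
      by_cases h1 : r = kr KR.fam2; · subst h1; simp
      rw [Function.update_of_ne h1]
      by_cases h2 : r = kr KR.md; · subst h2; rw [ocSt_md, hN.md]
      rw [ocSt_other _ _ _ _ h1 h2 h0]
    rw [e]; exact hN.upd_fam2_pr _ _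
  have h2 := runs_newVar (ocSt S fam2 [] (rbits x)) F cap zs hN' x (by simp) hzs Lf hxL hF
  rw [update_ocSt_pr, update_ocSt_oc] at h2
  have h2' : Runs (pop (kr KR.fnd) fun o => match o with
      | some _ => clear (kr KR.key) ;; clear (kr KR.pr)
      | none => newVar cap) (ocSt S fam2 [] (rbits x))
      (ocSt (Function.update S (kr KR.oc) (wRecs (ocRecs F cap (zs ++ [x])))) fam2 [] [])
      (nvCost Lf (wRecs (ocRecs F cap zs)).length (wFam F).length cap + 2) :=
    Runs.pop_nil (by rw [ocSt_fnd, hN.fnd]) h2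
  refine (h1.seq h2').mono ?_
  have hm : (12 * (rbits x).length + 44) * (wRecs (ocRecs F cap zs)).length ≤ (12 * Lf + 44) * (wRecs (ocRecs F cap zs)).length :=
    Nat.mul_le_mul_right _ (by omega)
  unfold litOcCost
  omega

end OcSpec

/-! ### Building the occurrence table: the pass -/

/-- `litOcCost` is monotone in the table length. [folklore] -/
theorem litOcCost_mono (Lf Wf cap : ℕ) {Lo Lo' : ℕ} (h : Lo ≤ Lo') : litOcCost Lf Lo Wf cap ≤ litOcCost Lf Lo' Wf cap := by
  unfold litOcCost nvCost cK xK
  gcongr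

/-- The store with the table of the first occurrences among `seen`. [folklore] -/
def ocBase (S : RStore) (F : List (List (ℕ × Bool))) (cap : ℕ) (seen : List ℕ) : RStore :=
  Function.update S (kr KR.oc) (wRecs (ocRecs F cap seen.eraseDups))

/-- The table of a prefix is a prefix of the table. [folklore] -/
theorem length_wRecs_prefix_le (F : List (List (ℕ × Bool))) (cap : ℕ) (seen more : List ℕ) :
    (wRecs (ocRecs F cap seen.eraseDups)).length ≤ (wRecs (ocRecs F cap (seen ++ more).eraseDups)).length := by
  rw [eraseDups_append]
  unfold ocRecs
  rw [List.map_append, wRecs_append, List.length_append]; omega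

section OcPass

variable (S : RStore) (F : List (List (ℕ × Bool))) (cap Lf : ℕ) (hN : NvBase S F cap []) (hF : ∀ c ∈ F, ∀ l ∈ c, (rbits l.1).length ≤ Lf)
include hN hF

omit hF in
/-- The base invariant along the pass. [folklore] -/
theorem nvBase_ocBase (seen : List ℕ) : NvBase (ocBase S F cap seen) F cap seen.eraseDups := hN.upd_oc _

omit hN hF in
/-- Index bits go to `pr` (mode `blank`). [folklore] -/
theorem segRuns_oc_bits (T : RStore) : ∀ (u : List Bool) (rest pr : List Γ'),
    SegRuns (kr KR.fam2) (ocBody cap) (u.map Γ'.bit) (ocSt T (u.map Γ'.bit ++ rest) [Γ'.blank] pr)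
      (ocSt T rest [Γ'.blank] ((u.map Γ'.bit).reverse ++ pr)) (6 * u.length)
  | [], rest, pr => by simpa using SegRuns.nil (kr KR.fam2) (ocBody cap) _
  | d :: u, rest, pr => by
    have hbody : Runs (ocBody cap (Γ'.bit d)) (Function.update (ocSt T (Γ'.bit d :: (u.map Γ'.bit ++ rest)) [Γ'.blank] pr) (kr KR.fam2) (u.map Γ'.bit ++ rest))
        (ocSt T (u.map Γ'.bit ++ rest) [Γ'.blank] (Γ'.bit d :: pr)) (2 + 2) := by
      rw [update_ocSt_fam2]; unfold ocBody
      refine Runs.pop_cons (k := kr KR.md) (a := Γ'.blank) (w := []) (by simp) ?_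
      rw [update_ocSt_md]
      exact ((Runs.push' (R' := ocSt T (u.map Γ'.bit ++ rest) [] (Γ'.bit d :: pr)) (by simp)).seq (Runs.push' (by simp))).of_eq rfl (by norm_num)
    have ih := segRuns_oc_bits T u rest (Γ'.bit d :: pr)
    have hk : ocSt T (Γ'.bit d :: (u.map Γ'.bit ++ rest)) [Γ'.blank] pr (kr KR.fam2) = Γ'.bit d :: (u.map Γ'.bit ++ rest) := by simp
    refine (SegRuns.cons hk hbody ih).cast (by simp) (by simp) (by simp) ?_
    simp only [List.length_cons]; omega

/-- **One literal of the pass.** [folklore] -/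
theorem segRuns_oc_literal (Lo : ℕ) (hLo : (wRecs (ocRecs F cap (occList F))).length ≤ Lo) (seen rest : List ℕ) (x : ℕ) (q : Bool)
    (hctx : (F.flatMap fun c => c.map Prod.fst) = seen ++ x :: rest) (rest' : List Γ') :
    SegRuns (kr KR.fam2) (ocBody cap) (KCNF.encodeLiteral (x, q)) (ocSt (ocBase S F cap seen) (KCNF.encodeLiteral (x, q) ++ rest') [] [])
      (ocSt (ocBase S F cap (seen ++ [x])) rest' [] []) ((litOcCost Lf Lo (wFam F).length cap + 6) * (KCNF.encodeLiteral (x, q)).length) := by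
  have hxL : (rbits x).length ≤ Lf := by
    have hx : x ∈ F.flatMap fun c => c.map Prod.fst := by rw [hctx]; simp
    obtain ⟨c, hc, hx'⟩ := List.mem_flatMap.1 hx
    obtain ⟨l, hl, rfl⟩ := List.mem_map.1 hx'
    exact hF c hc l hl
  have hLo' : (wRecs (ocRecs F cap seen.eraseDups)).length ≤ Lo := by
    refine le_trans ?_ hLo
    have := length_wRecs_prefix_le F cap seen (x :: rest)
    rwa [← hctx] at this
  have hlit : KCNF.encodeLiteral (x, q) = Γ'.bit q :: ((encodeNat x).map Γ'.bit ++ [Γ'.comma]) := rfl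
  rw [hlit]
  set T := ocBase S F cap seen with hT
  set bs := (encodeNat x).map Γ'.bit with hbs
  have h1 : Runs (ocBody cap (Γ'.bit q)) (Function.update (ocSt T (Γ'.bit q :: (bs ++ [Γ'.comma]) ++ rest') [] []) (kr KR.fam2) (bs ++ [Γ'.comma] ++ rest'))
      (ocSt T (bs ++ [Γ'.comma] ++ rest') [Γ'.blank] []) (1 + 2) := by
    rw [update_ocSt_fam2]; unfold ocBody
    exact Runs.pop_nil (by simp) (Runs.push' (by simp))
  have h2 := segRuns_oc_bits cap T (encodeNat x) ([Γ'.comma] ++ rest') []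
  rw [← hbs] at h2
  simp only [List.append_nil] at h2
  have hrb : bs.reverse = rbits x := rfl
  rw [hrb] at h2
  have h3 : Runs (ocBody cap Γ'.comma) (Function.update (ocSt T ([Γ'.comma] ++ rest') [Γ'.blank] (rbits x)) (kr KR.fam2) rest')
      (ocSt (ocBase S F cap (seen ++ [x])) rest' [] []) (litOcCost Lf Lo (wFam F).length cap + 2) := by
    rw [update_ocSt_fam2]; unfold ocBody
    refine Runs.pop_cons (k := kr KR.md) (a := Γ'.blank) (w := []) (by simp) ?_
    rw [update_ocSt_md]
    have hNT : NvBase T F cap seen.eraseDups := nvBase_ocBase S F cap hN seen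
    by_cases hx : x ∈ seen
    · have h := runs_litOc_old F cap Lf T seen.eraseDups hNT x (List.mem_eraseDups.2 hx) hxL rest'
      refine h.of_eq ?_ (litOcCost_mono _ _ _ hLo')
      rw [hT, ocBase, ocBase, eraseDups_append_singleton, if_pos hx]
    · have hzs : ∀ z, z ∈ seen.eraseDups ↔ z ∈ pre F x := fun z => by rw [pre_eq_eraseDups F seen rest x hctx hx]
      have h := runs_litOc_new F cap Lf hF T seen.eraseDups hNT x (fun h => hx (List.mem_eraseDups.1 h)) hzs hxL rest'
      refine h.of_eq ?_ (litOcCost_mono _ _ _ hLo')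
      rw [hT, ocBase, ocBase, Function.update_idem, eraseDups_append_singleton, if_neg hx]
  have hk1 : ocSt T (Γ'.bit q :: (bs ++ [Γ'.comma]) ++ rest') [] [] (kr KR.fam2) = Γ'.bit q :: (bs ++ [Γ'.comma] ++ rest') := by simp
  have hk3 : ocSt T ([Γ'.comma] ++ rest') [Γ'.blank] (rbits x) (kr KR.fam2) = Γ'.comma :: rest' := by simp
  have h23 := h2.append (SegRuns.single hk3 h3)
  have := SegRuns.cons hk1 h1 (h23.cast rfl (by simp) rfl le_rfl)
  refine this.cast (by simp) rfl rfl ?_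
  simp only [List.length_cons, List.length_append, List.length_nil, List.length_map, hbs]
  nlinarith

/-- **The literals of a clause.** [folklore] -/
theorem segRuns_oc_lits (Lo : ℕ) (hLo : (wRecs (ocRecs F cap (occList F))).length ≤ Lo) :
    ∀ (lits : List (ℕ × Bool)) (seen rest : List ℕ), (F.flatMap fun c => c.map Prod.fst) = seen ++ lits.map Prod.fst ++ rest →
    ∀ (rest' : List Γ'),
    SegRuns (kr KR.fam2) (ocBody cap) (cbody lits) (ocSt (ocBase S F cap seen) (cbody lits ++ rest') [] [])
      (ocSt (ocBase S F cap (seen ++ lits.map Prod.fst)) rest' [] []) ((litOcCost Lf Lo (wFam F).length cap + 6) * (cbody lits).length)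
  | [], seen, rest, _, rest' => by simpa using SegRuns.nil (kr KR.fam2) (ocBody cap) _
  | l :: lits, seen, rest, hctx, rest' => by
    have h1 := segRuns_oc_literal S F cap Lf hN hF Lo hLo seen (lits.map Prod.fst ++ rest) l.1 l.2 (by rw [hctx]; simp) (cbody lits ++ rest')
    have h2 := segRuns_oc_lits Lo hLo lits (seen ++ [l.1]) rest (by rw [hctx]; simp) rest'
    have := h1.append h2
    refine this.cast (by simp [cbody_cons, encodeLiteral_eq]) (by simp [cbody_cons, encodeLiteral_eq]) (by simp) ?_
    simp only [cbody_cons, encodeLiteral_eq, List.length_append, List.length_cons, List.length_nil]; ring_nf; omega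

/-- **One clause.** [folklore] -/
theorem segRuns_oc_clause (Lo : ℕ) (hLo : (wRecs (ocRecs F cap (occList F))).length ≤ Lo) (c : List (ℕ × Bool)) (seen rest : List ℕ)
    (hctx : (F.flatMap fun c => c.map Prod.fst) = seen ++ c.map Prod.fst ++ rest) (rest' : List Γ') :
    SegRuns (kr KR.fam2) (ocBody cap) (KCNF.encodeClause c) (ocSt (ocBase S F cap seen) (KCNF.encodeClause c ++ rest') [] [])
      (ocSt (ocBase S F cap (seen ++ c.map Prod.fst)) rest' [] []) ((litOcCost Lf Lo (wFam F).length cap + 6) * (KCNF.encodeClause c).length) := by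
  have hw : KCNF.encodeClause c = Γ'.bra :: (cbody c ++ [Γ'.ket]) := by simp [KCNF.encodeClause, cbody]
  rw [hw]
  set T := ocBase S F cap seen with hT
  have h0 : Runs (ocBody cap Γ'.bra) (Function.update (ocSt T (Γ'.bra :: (cbody c ++ [Γ'.ket]) ++ rest') [] []) (kr KR.fam2) (cbody c ++ [Γ'.ket] ++ rest'))
      (ocSt T (cbody c ++ [Γ'.ket] ++ rest') [] []) (0 + 2) := by
    rw [update_ocSt_fam2]; unfold ocBody
    exact Runs.pop_nil (by simp) ((Runs.skip _).of_eq (by simp) le_rfl)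
  have hk0 : ocSt T (Γ'.bra :: (cbody c ++ [Γ'.ket]) ++ rest') [] [] (kr KR.fam2) = Γ'.bra :: (cbody c ++ [Γ'.ket] ++ rest') := by simp
  have h1 := segRuns_oc_lits S F cap Lf hN hF Lo hLo c seen rest hctx ([Γ'.ket] ++ rest')
  rw [← hT] at h1
  set T' := ocBase S F cap (seen ++ c.map Prod.fst)
  have h2 : Runs (ocBody cap Γ'.ket) (Function.update (ocSt T' ([Γ'.ket] ++ rest') [] []) (kr KR.fam2) rest') (ocSt T' rest' [] []) (0 + 2) := by
    rw [update_ocSt_fam2]; unfold ocBody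
    exact Runs.pop_nil (by simp) ((Runs.skip _).of_eq (by simp) le_rfl)
  have hk2 : ocSt T' ([Γ'.ket] ++ rest') [] [] (kr KR.fam2) = Γ'.ket :: rest' := by simp
  have := SegRuns.cons hk0 h0 ((h1.append (SegRuns.single hk2 h2)).cast rfl (by simp) rfl le_rfl)
  refine this.cast rfl rfl rfl ?_
  simp only [List.length_cons, List.length_append, List.length_nil]; nlinarith

/-- **The clauses.** [folklore] -/
theorem segRuns_oc_clauses (Lo : ℕ) (hLo : (wRecs (ocRecs F cap (occList F))).length ≤ Lo) :
    ∀ (G : List (List (ℕ × Bool))) (seen : List ℕ), (F.flatMap fun c => c.map Prod.fst) = seen ++ G.flatMap (fun c => c.map Prod.fst) →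
    ∀ (rest' : List Γ'),
    SegRuns (kr KR.fam2) (ocBody cap) (wFam G) (ocSt (ocBase S F cap seen) (wFam G ++ rest') [] [])
      (ocSt (ocBase S F cap (seen ++ G.flatMap fun c => c.map Prod.fst)) rest' [] []) ((litOcCost Lf Lo (wFam F).length cap + 6) * (wFam G).length)
  | [], seen, _, rest' => by simpa [wFam] using SegRuns.nil (kr KR.fam2) (ocBody cap) _
  | c :: G, seen, hctx, rest' => by
    have h1 := segRuns_oc_clause S F cap Lf hN hF Lo hLo c seen (G.flatMap fun c => c.map Prod.fst) (by rw [hctx]; simp) (wFam G ++ rest')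
    have h2 := segRuns_oc_clauses Lo hLo G (seen ++ c.map Prod.fst) (by rw [hctx]; simp) rest'
    have := h1.append h2
    have hwc : wFam (c :: G) = KCNF.encodeClause c ++ wFam G := by rw [wFam_cons]; simp [KCNF.encodeClause, cbody]
    refine this.cast hwc.symm (by rw [hwc, List.append_assoc]) (by simp) ?_
    rw [hwc, List.length_append]; ring_nf; omega

/-- **Specification of `ocBuild`.** Started with an empty table, it ends with the occurrence table
of all occurring variables in the order of first occurrence. [folklore] -/
theorem runs_ocBuild (hfam2 : S (kr KR.fam2) = []) (hpr : S (kr KR.pr) = []) :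
    Runs (ocBuild cap) S (Function.update S (kr KR.oc) (wRecs (ocRecs F cap (occList F))))
      ((litOcCost Lf (wRecs (ocRecs F cap (occList F))).length (wFam F).length cap + 16) * (wFam F).length + 4) := by
  have eb0 : ocBase S F cap [] = S := by
    unfold ocBase; exact Function.update_eq_self_iff.2 (by rw [hN.oc]; rfl)
  have e0 : ocSt S [] [] [] = S := by
    funext r
    by_cases h0 : r = kr KR.fam2; · subst h0; simp [hfam2]
    by_cases h1 : r = kr KR.md; · subst h1; simp [hN.md]
    by_cases h2 : r = kr KR.pr; · subst h2; simp [hpr]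
    rw [ocSt_other _ _ _ _ h0 h1 h2]
  unfold ocBuild
  have h0 := runs_copyToG (a := kr KR.fam) (b := kr KR.fam2) (t₁ := kr KR.t1) (t₂ := kr KR.t2)
    (by simp) (by simp) (by simp) (by simp) (by simp) (by simp) (ocSt S [] [] []) (by simp [hN.t1]) (by simp [hN.t2]) (by simp)
  rw [ocSt_fam, hN.fam, update_ocSt_fam2] at h0
  have h1 := (segRuns_oc_clauses S F cap Lf hN hF _ le_rfl F [] (by simp) []).runs_loop_nil (by simp)
  simp only [List.append_nil, List.nil_append, eb0] at h1
  rw [e0] at h0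
  refine (h0.seq h1).of_eq ?_ (by nlinarith)
  unfold ocBase
  rw [← update_ocSt_oc, e0, occList]

end OcPass

end Literature.Computability.FineGrained.IPRenameM
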